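import Summits.PneNP.PneNP.Theorems.IP3DensityCount
import Summits.PneNP.PneNP.Theorems.IP3ExpandingExist
import Summits.PneNP.PneNP.Theorems.SASubThreshold

/-!
# Density-uniform expanding pure `IP₃` instances, II: the estimate and T23.1-A `IP3ExpandingDensity` (cell `pnp-ideate`, ROUND-23)

FRONTIER range-avoidance ladder, rung F-N3 context (restricted-model combinatorics; nothing here bears on `P` vs `NP`).
Closes `SASubThreshold.IP3ExpandingDensity` BY NAME (`ip3ExpandingDensity`): for every `t ≥ 2` there is `c > 0`
(`c = 466560^{2t}·5^{t−1}`) such that for every density `Δ ≥ 1` and every `N₀` some pure-`IP₃` instance on `n ≥ N₀` variables with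
exactly `Δ·n` outputs is `(r, (3t+1)/t)`-boundary expanding for EVERY radius `r` with `c·Δ^{2t}·r^{t−1} ≤ n^{t−1}`.  First moment over
the ROUND-22 model (`IP3ExpandingModel`, union bound `IP3DensityCount.card_badSetD_le`) — prover-1's `PstarDensityExist` at arity `6`:
* `termD_le` — `C(m,f)·C(N, v)·(64v⁶/N⁶)^f ≤ 2^{−f}` (`v = vD t f`, `m ≤ ΔN`) under `(466560Δ)^{2t}·(5f)^{t−1} ≤ N^{t−1}`: after
  `IP3ExpandingExist.key_identity6` the term is `≤ (233280Δ)^f·(5f/N)^q` with the slack `2t·q ≥ (t−1)·f` (`slackD_le`); the comparison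
  is done at the `2t`-th power;
* `card_badSetD_lt`, `exists_goodD`; `ip3ExpandingDensity` — the instance is chosen good at the largest admissible radius
  (`Nat.findGreatest`) and expansion is handed down by `badD_mono`.
With the hub `PairwiseSA.pairwiseSALinearLevel` and `IP3ExpandingExist.ip3PairwiseLaws'` this feeds
`SASubThreshold.ip3SASubThresholdBlind_of` (HEADLINE-23-A).
-/

set_option linter.dupNamespace false

open Finset Literature.Computability.Complexity
open Summit.PneNP.PneNP.Theorems.PstarSASDPLevel (BoundaryExpandingQ)
open Summit.PneNP.PneNP.Theorems.IP3ExpandingModel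
open Summit.PneNP.PneNP.Theorems.IP3ExpandingExist (key_identity6 pow_six_le)
open Summit.PneNP.PneNP.Theorems.PstarExpandingExist (choose_le geom_half_lt_one)
open Summit.PneNP.PneNP.Theorems.IP3DensityCount

namespace Summit.PneNP.PneNP.Theorems.IP3DensityExist

variable {N m : ℕ}

/-! ## Arithmetic of the radius condition -/

/-- The radius condition forces `5r ≤ N` (for `t ≥ 2`, `Δ ≥ 1`). -/
theorem five_mul_le_of_hyp {t Δ N r : ℕ} (ht : 2 ≤ t) (hΔ : 1 ≤ Δ)
    (hH : (466560 * Δ) ^ (2 * t) * (5 * r) ^ (t - 1) ≤ N ^ (t - 1)) : 5 * r ≤ N := by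
  have h1 : 1 ≤ (466560 * Δ) ^ (2 * t) := Nat.one_le_pow _ _ (by omega)
  have h2 : (5 * r) ^ (t - 1) ≤ N ^ (t - 1) := le_trans (Nat.le_mul_of_pos_left _ h1) hH
  exact (Nat.pow_le_pow_iff_left (by omega)).1 h2

/-! ## The term estimate -/

/-- **The density-uniform term estimate.**  For `t, f ≥ 1`, `m ≤ ΔN`, `5f ≤ N` and `(466560Δ)^{2t}(5f)^{t−1} ≤ N^{t−1}`:
`C(m,f)·C(N, vD t f)·(64(vD t f)⁶/N⁶)^f ≤ 2^{−f}`. -/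
theorem termD_le (t Δ N f m : ℕ) (ht : 1 ≤ t) (hf : 1 ≤ f) (hm : m ≤ Δ * N)
    (hH : (466560 * Δ) ^ (2 * t) * (5 * f) ^ (t - 1) ≤ N ^ (t - 1)) (h5f : 5 * f ≤ N) :
    (m.choose f : ℝ) * (N.choose (vD t f) : ℝ) * (64 * ((vD t f : ℕ) : ℝ) ^ 6 / (N : ℝ) ^ 6) ^ f ≤ (1 / 2) ^ f := by
  set v := vD t f with hvdef
  set q := 5 * f - v with hqdef
  have hv5 : v ≤ 5 * f := vD_le t f ht
  have hvq : f + v + q = 6 * f := by omega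
  have hv1 : 1 ≤ v := one_le_vD ht hf
  have hslack : (t - 1) * f ≤ 2 * t * q := slackD_le t f ht hf
  have hN1 : 1 ≤ N := by omega
  have hfR : (0 : ℝ) < f := by exact_mod_cast hf
  have hvR : (0 : ℝ) < v := by exact_mod_cast hv1
  have hNR : (0 : ℝ) < N := by exact_mod_cast hN1
  have hΔR : (0 : ℝ) ≤ Δ := by positivity
  -- the two binomials
  have hA : (m.choose f : ℝ) ≤ (3 * Δ * N / f) ^ f := by
    refine (choose_le m f hf).trans (pow_le_pow_left₀ (by positivity) ?_ _)
    have : (m : ℝ) ≤ Δ * N := by exact_mod_cast hm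
    rw [div_le_div_iff_of_pos_right hfR]
    linarith
  have hB : (N.choose v : ℝ) ≤ (3 * N / v) ^ v := choose_le N v hv1
  have hE : (m.choose f : ℝ) * (N.choose v : ℝ) * (64 * (v : ℝ) ^ 6 / (N : ℝ) ^ 6) ^ f ≤
      (3 * Δ * N / f) ^ f * (3 * N / v) ^ v * (64 * (v : ℝ) ^ 6 / (N : ℝ) ^ 6) ^ f := by
    have h0 : (0 : ℝ) ≤ (64 * (v : ℝ) ^ 6 / (N : ℝ) ^ 6) ^ f := by positivity
    exact mul_le_mul_of_nonneg_right (mul_le_mul hA hB (by positivity) (by positivity)) h0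
  rw [key_identity6 Δ N v f hfR.ne' hvR.ne' hNR.ne' f v q hvq] at hE
  refine hE.trans ?_
  -- bound by `(233280Δ)^f · x^q`, `x = 5f/N`
  set x : ℝ := 5 * (f : ℝ) / N with hxdef
  have hx0 : 0 ≤ x := by positivity
  have hx1 : x ≤ 1 := by
    rw [hxdef, div_le_one hNR]
    exact_mod_cast h5f
  have f1 : (192 * Δ * v / f : ℝ) ^ f ≤ (960 * Δ) ^ f := by
    refine pow_le_pow_left₀ (by positivity) ?_ _
    rw [div_le_iff₀ hfR]
    have : (v : ℝ) ≤ 5 * f := by exact_mod_cast hv5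
    nlinarith
  have f2 : (3 : ℝ) ^ v ≤ 243 ^ f := by
    calc (3 : ℝ) ^ v ≤ 3 ^ (5 * f) := pow_le_pow_right₀ (by norm_num) hv5
      _ = 243 ^ f := by rw [pow_mul]; norm_num
  have f3 : ((v : ℝ) / N) ^ q ≤ x ^ q := by
    refine pow_le_pow_left₀ (by positivity) ?_ _
    rw [hxdef, div_le_div_iff_of_pos_right hNR]
    exact_mod_cast hv5
  have hU : (192 * Δ * v / f : ℝ) ^ f * 3 ^ v * ((v : ℝ) / N) ^ q ≤ (233280 * Δ) ^ f * x ^ q := by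
    have h := mul_le_mul (mul_le_mul f1 f2 (by positivity) (by positivity)) f3 (by positivity) (by positivity)
    refine h.trans (le_of_eq ?_)
    rw [← mul_pow]
    ring
  refine hU.trans ?_
  -- compare `2t`-th powers
  have h2t : 2 * t ≠ 0 := by omega
  rw [← pow_le_pow_iff_left₀ (by positivity) (by positivity) h2t]
  have hbase : ((233280 : ℝ) * Δ) ^ (2 * t) * x ^ (t - 1) ≤ ((1 : ℝ) / 2) ^ (2 * t) := by
    have hHR : ((466560 : ℝ) * Δ) ^ (2 * t) * (5 * (f : ℝ)) ^ (t - 1) ≤ (N : ℝ) ^ (t - 1) := by exact_mod_cast hH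
    rw [hxdef, div_pow, ← mul_div_assoc, div_le_iff₀ (by positivity), div_pow, one_pow,
      div_mul_eq_mul_div, le_div_iff₀ (by positivity)]
    calc ((233280 : ℝ) * Δ) ^ (2 * t) * (5 * (f : ℝ)) ^ (t - 1) * 2 ^ (2 * t)
        = ((466560 : ℝ) * Δ) ^ (2 * t) * (5 * (f : ℝ)) ^ (t - 1) := by
          rw [show (466560 : ℝ) * Δ = 233280 * Δ * 2 by ring, mul_pow (233280 * (Δ : ℝ)) 2]; ring
      _ ≤ (N : ℝ) ^ (t - 1) := hHR
      _ = 1 * (N : ℝ) ^ (t - 1) := (one_mul _).symm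
  calc (((233280 : ℝ) * Δ) ^ f * x ^ q) ^ (2 * t)
      = ((233280 : ℝ) * Δ) ^ (2 * t * f) * x ^ (2 * t * q) := by
        rw [mul_pow, ← pow_mul, ← pow_mul, Nat.mul_comm f, Nat.mul_comm q]
    _ ≤ ((233280 : ℝ) * Δ) ^ (2 * t * f) * x ^ ((t - 1) * f) :=
        mul_le_mul_of_nonneg_left (pow_le_pow_of_le_one hx0 hx1 hslack) (by positivity)
    _ = (((233280 : ℝ) * Δ) ^ (2 * t) * x ^ (t - 1)) ^ f := by
        rw [mul_pow (((233280 : ℝ) * Δ) ^ (2 * t)) (x ^ (t - 1)) f, ← pow_mul, ← pow_mul]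
    _ ≤ (((1 : ℝ) / 2) ^ (2 * t)) ^ f := pow_le_pow_left₀ (by positivity) hbase _
    _ = (((1 : ℝ) / 2) ^ f) ^ (2 * t) := by rw [← pow_mul, ← pow_mul, Nat.mul_comm]

/-! ## Existence -/

/-- **Good outcomes are rarer than outcomes**: for `t ≥ 2`, `Δ ≥ 1`, `N ≥ 10` and a radius `r` with
`(466560Δ)^{2t}(5r)^{t−1} ≤ N^{t−1}`, fewer outcomes with `Δ·N` outputs are bad than there are outcomes. -/
theorem card_badSetD_lt (t Δ N r : ℕ) (ht : 2 ≤ t) (hΔ : 1 ≤ Δ) (hN : 10 ≤ N)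
    (hH : (466560 * Δ) ^ (2 * t) * (5 * r) ^ (t - 1) ≤ N ^ (t - 1)) :
    ((badSetD N (Δ * N) t r).card : ℝ) < (Fintype.card (Outcome6 N (Δ * N)) : ℝ) := by
  set m := Δ * N with hmdef
  have ht1 : 1 ≤ t := by omega
  have hr5 : 5 * r ≤ N := five_mul_le_of_hyp ht hΔ hH
  set Q : ℕ := Fintype.card (Fin 6 ↪ Fin N) with hQ
  have hcardΩ : Fintype.card (Outcome6 N m) = Q ^ m := by
    rw [Fintype.card_fun, Fintype.card_fin]
  have hQ64 : (N : ℝ) ^ 6 ≤ 64 * (Q : ℝ) := pow_six_le N hN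
  have hNR : (0 : ℝ) < N := by exact_mod_cast (show 0 < N by omega)
  have hQpos : (0 : ℝ) < Q := by
    have : (0 : ℝ) < (N : ℝ) ^ 6 := by positivity
    linarith
  have hub := card_badSetD_le (m := m) ht1 r hr5
  refine lt_of_le_of_lt hub ?_
  rw [hcardΩ]
  push_cast
  have hterm : ∀ i ∈ Finset.range r,
      (m.choose (i + 1) : ℝ) * (N.choose (vD t (i + 1)) : ℝ) * ((((vD t (i + 1) : ℕ) : ℝ) ^ 6) ^ (i + 1)) *
          (Q : ℝ) ^ (m - (i + 1)) ≤ (1 / 2) ^ (i + 1) * (Q : ℝ) ^ m := by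
    intro i hi
    rw [Finset.mem_range] at hi
    have hHf : (466560 * Δ) ^ (2 * t) * (5 * (i + 1)) ^ (t - 1) ≤ N ^ (t - 1) :=
      le_trans (Nat.mul_le_mul_left _ (Nat.pow_le_pow_left (by omega) _)) hH
    have h5f : 5 * (i + 1) ≤ N := by omega
    have hsm : i + 1 ≤ m ∨ m < i + 1 := le_or_gt _ _
    have ht' := termD_le t Δ N (i + 1) m ht1 (by omega) le_rfl hHf h5f
    rcases hsm with hsm | hsm
    · have hQsplit : (Q : ℝ) ^ m = (Q : ℝ) ^ (i + 1) * (Q : ℝ) ^ (m - (i + 1)) := by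
        rw [← pow_add]; congr 1; omega
      rw [hQsplit]
      have hstep : ((((vD t (i + 1) : ℕ) : ℝ) ^ 6) ^ (i + 1)) ≤
          (64 * ((vD t (i + 1) : ℕ) : ℝ) ^ 6 / (N : ℝ) ^ 6) ^ (i + 1) * (Q : ℝ) ^ (i + 1) := by
        rw [← mul_pow]
        refine pow_le_pow_left₀ (by positivity) ?_ _
        rw [div_mul_eq_mul_div, le_div_iff₀ (by positivity)]
        have h0 : (0 : ℝ) ≤ ((vD t (i + 1) : ℕ) : ℝ) ^ 6 := by positivity
        nlinarith
      have hQm : (0 : ℝ) ≤ (Q : ℝ) ^ (m - (i + 1)) := by positivity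
      have hcc : (0 : ℝ) ≤ (m.choose (i + 1) : ℝ) * (N.choose (vD t (i + 1)) : ℝ) := by positivity
      calc (m.choose (i + 1) : ℝ) * (N.choose (vD t (i + 1)) : ℝ) * (((vD t (i + 1) : ℕ) : ℝ) ^ 6) ^ (i + 1) *
            (Q : ℝ) ^ (m - (i + 1))
          ≤ (m.choose (i + 1) : ℝ) * (N.choose (vD t (i + 1)) : ℝ) *
            ((64 * ((vD t (i + 1) : ℕ) : ℝ) ^ 6 / (N : ℝ) ^ 6) ^ (i + 1) * (Q : ℝ) ^ (i + 1)) *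
              (Q : ℝ) ^ (m - (i + 1)) :=
            mul_le_mul_of_nonneg_right (mul_le_mul_of_nonneg_left hstep hcc) hQm
        _ = ((m.choose (i + 1) : ℝ) * (N.choose (vD t (i + 1)) : ℝ) *
            (64 * ((vD t (i + 1) : ℕ) : ℝ) ^ 6 / (N : ℝ) ^ 6) ^ (i + 1)) *
              ((Q : ℝ) ^ (i + 1) * (Q : ℝ) ^ (m - (i + 1))) := by ring
        _ ≤ (1 / 2) ^ (i + 1) * ((Q : ℝ) ^ (i + 1) * (Q : ℝ) ^ (m - (i + 1))) :=
            mul_le_mul_of_nonneg_right ht' (by positivity)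
    · rw [Nat.choose_eq_zero_of_lt hsm]
      simp only [Nat.cast_zero, zero_mul]
      positivity
  refine (Finset.sum_le_sum hterm).trans_lt ?_
  rw [← Finset.sum_mul]
  have hQm : (0 : ℝ) < (Q : ℝ) ^ m := by positivity
  calc (∑ i ∈ Finset.range r, (1 / 2 : ℝ) ^ (i + 1)) * (Q : ℝ) ^ m < 1 * (Q : ℝ) ^ m :=
        mul_lt_mul_of_pos_right (geom_half_lt_one r) hQm
    _ = (Q : ℝ) ^ m := one_mul _

/-- **A good outcome exists** (same hypotheses). -/
theorem exists_goodD (t Δ N r : ℕ) (ht : 2 ≤ t) (hΔ : 1 ≤ Δ) (hN : 10 ≤ N)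
    (hH : (466560 * Δ) ^ (2 * t) * (5 * r) ^ (t - 1) ≤ N ^ (t - 1)) :
    ∃ ω : Outcome6 N (Δ * N), ¬badD t r ω := by
  classical
  by_contra h
  push Not at h
  have hall : badSetD N (Δ * N) t r = univ :=
    Finset.eq_univ_of_forall fun ω => by
      unfold badSetD
      exact Finset.mem_filter.2 ⟨Finset.mem_univ _, h ω⟩
  have := card_badSetD_lt t Δ N r ht hΔ hN hH
  rw [hall, Finset.card_univ] at this
  exact lt_irrefl _ this

/-- **T23.1-A — density-uniform boundary expansion for pure `IP₃`** (closes `SASubThreshold.IP3ExpandingDensity` by name), with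
`c = 466560^{2t}·5^{t−1}`: for every `t ≥ 2`, every density `Δ ≥ 1` and every `N₀` some pure-`IP₃` instance on `n ≥ N₀` variables
with `Δ·n` outputs is `(r, (3t+1)/t)`-boundary expanding for every `r` with `c·Δ^{2t}·r^{t−1} ≤ n^{t−1}`.  Restricted-model
combinatorics (cell pnp-ideate, ROUND-23); it says nothing about `P` versus `NP`. -/
theorem ip3ExpandingDensity : SASubThreshold.IP3ExpandingDensity := by
  classical
  intro t ht
  refine ⟨466560 ^ (2 * t) * 5 ^ (t - 1), by positivity, fun Δ N₀ hΔ => ?_⟩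
  set N := max N₀ 10 with hNdef
  have hN10 : 10 ≤ N := le_max_right _ _
  have h0 : (466560 * Δ) ^ (2 * t) * (5 * 0) ^ (t - 1) ≤ N ^ (t - 1) := by
    rw [mul_zero, zero_pow (by omega), mul_zero]
    exact Nat.zero_le _
  have hr₀P : (466560 * Δ) ^ (2 * t) * (5 * Nat.findGreatest
      (fun r => (466560 * Δ) ^ (2 * t) * (5 * r) ^ (t - 1) ≤ N ^ (t - 1)) N) ^ (t - 1) ≤ N ^ (t - 1) :=
    Nat.findGreatest_spec (P := fun r => (466560 * Δ) ^ (2 * t) * (5 * r) ^ (t - 1) ≤ N ^ (t - 1)) (Nat.zero_le N) h0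
  obtain ⟨ω, hω⟩ := exists_goodD t Δ N _ ht hΔ hN10 hr₀P
  refine ⟨N, le_max_left N₀ 10, inst6 ω, isPure_inst6 ω, fun r hr => ?_⟩
  have hH : (466560 * Δ) ^ (2 * t) * (5 * r) ^ (t - 1) ≤ N ^ (t - 1) := by
    have e1 : 466560 ^ (2 * t) * 5 ^ (t - 1) * Δ ^ (2 * t) * r ^ (t - 1) =
        (466560 * Δ) ^ (2 * t) * (5 * r) ^ (t - 1) := by
      rw [mul_pow, mul_pow]; ring
    rw [e1] at hr
    exact hr
  have hrN : r ≤ N := by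
    have := five_mul_le_of_hyp ht hΔ hH
    omega
  have hrr₀ : r ≤ Nat.findGreatest (fun r => (466560 * Δ) ^ (2 * t) * (5 * r) ^ (t - 1) ≤ N ^ (t - 1)) N :=
    Nat.le_findGreatest hrN hH
  exact boundaryExpandingQ_of_not_badD t r ω fun hb => hω (badD_mono hrr₀ hb)

end Summit.PneNP.PneNP.Theorems.IP3DensityExist
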